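import Summits.QuantumFields.BalabanUV.Beta.GAN24.DerivativeRateTransferJensenMassFreeKarcherEquation
import Summits.QuantumFields.BalabanUV.Beta.GAN24.DerivativeRateTransferJensenMassFreeConventionLocal

/-!
# `BalabanUV.Beta.GAN24.DerivativeRateTransferJensenMassFreeKarcherLocal` — binder row G-an2-4 ∕ (CONV-C), route R6 «VALUES, NOT DERIVATIVES», PART 82:
# THE KARCHER BASE OF ONE COARSE BOND, SUPPORT-LOCAL, IN PART 58 ∕ 62's LETTERS — PART 77's Karcher base and its transfer letter restated for weights with a
# support (`{x ∕∕ q x ≠ 0}`), the POINTWISE loop letter `|((τ_x)ᵀτ_{x′} − 1)w|² ≤ D²|w|²` on pairs of sites of nonzero weight (`D_F = √(dim o)·D ≤ 1∕200`),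
# the reference transport `τ_{x₀}` at ANY prescribed root of nonzero weight, and the polar letters in defect form: PART 56's `hτ` for the (1.27) ∕ (1.29) link,
# `|(V(e′) − R′(e′))w|² ≤ (1280D_F³ + 200704D_F⁴)²|w|²` — the glue to PART 62's local END, as PART 71 was for (1.28) (unit b2b-balaban-gan24-p3, gen 46; v1)

NOT IN PRINT; OUR PROOF (for the ROUTE; PART 77 `karcher_base_of_transports` on the support subtype + PART 71's bookkeeping `sum_support_smul` ∕
`sum_support_weight` ∕ `frob_loop_base_change` ∕ `polarLetters_of_defectLetters` + PART 69 `frob_norm_le_sqrt_card_mul` BY NAME).  HONEST FRAMING (cell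
contract, verbatim): «discharging `BetaPertH` makes Bałaban's UV stability UNCONDITIONAL — a real constructive-QFT result; it is NOT the continuum limit and NOT
the Clay problem.»  HONEST DEPENDENCY (verbatim): «continuum YM on T⁴ ⇐ BetaPertH ∧ nine spine estimates (0/9 proved); BetaPertH ⇐ (D1) ∧ (D4) ∧ CAP+tail;
G-an2-4 gates asym, D1 and NE2/3/4.»

WHAT THIS FILE PROVES (0 sorry, 0 `def`, nothing cited): **`karcher_base_local`** (one coarse bond: ∃ orthogonal `V` with `‖V·τ_{x₀}ᵀ − 1‖ ≤ 8D_F`, skew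
logarithms on the support `exp(C_x)·V = τ_x`, `‖C_x‖ ≤ 8D_F`, `Σ_{q≠0} q_x•C_x = 0`, and `‖R′ − V‖ ≤ 1280D_F³ + 200704D_F⁴` for every polar link),
**`transferLetter_karcher_local`** (bond-indexed, roots prescribed, polar letters in defect form: ∃ `V C` with the Karcher equations and PART 56's `hτ`).
HONEST SCOPE: crude window and constants; ONE scale; NOT the tower, NOT (CONS), NOT (CONV-C).  SUPPLIER work on route R6 (rank 2, REDUCTION, no seat); no
consumer of record; NEVER «G-an2-4 closed»; NOT (CONV-C), NOT D1, NOT `BetaPertH`, NOT continuum, NOT Clay.  Records: `HOME/b2b-balaban-gan24-p3/WOODBURY-FIBRE.md` v14.6. -/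

noncomputable section

open scoped Matrix Matrix.Norms.Frobenius NNReal
open NormedSpace Finset Matrix Metric Set

namespace Summit.QuantumFields.BalabanUV.Beta.GAN24.DerivativeRateTransferJensenMassFreeKarcherLocal

open Summit.QuantumFields.BalabanUV.Beta.GAN24.DerivativeRateTransferJensenMassFreePolarNear
open Summit.QuantumFields.BalabanUV.Beta.GAN24.DerivativeRateTransferJensenMassFreeLogarithm
open Summit.QuantumFields.BalabanUV.Beta.GAN24.DerivativeRateTransferJensenMassFreeConventionLocal
open Summit.QuantumFields.BalabanUV.Beta.GAN24.DerivativeRateTransferJensenMassFreeKarcherEquation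

variable {o ν : Type*} [Fintype o] [DecidableEq o] [Fintype ν]

/-- **`karcher_base_local` — ONE COARSE BOND, SUPPORT-LOCAL** [our proof]: weights `q ≥ 0`, `Σq = 1`, orthogonal transports `τ_x`, a site `x₀` of nonzero
weight, the POINTWISE loop letter `|((τ_x)ᵀτ_{x′} − 1)w|² ≤ D²|w|²` for `q_x, q_{x′} ≠ 0` with `0 ≤ D` and `√(dim o)·D ≤ 1∕200` ⟹ ∃ orthogonal `V` with
`‖V·(τ_{x₀})ᵀ − 1‖ ≤ 8√(dim o)D`, skew `C : {x ∕∕ q x ≠ 0} → …` with `exp(C_x)·V = τ_x`, `‖C_x‖ ≤ 8√(dim o)D`, `Σ_{q≠0} q_x•C_x = 0`, and EVERY orthogonal `R′`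
with `(Σ_x q_x•τ_x)·R′ᵀ` symmetric positive semidefinite satisfies `‖R′ − V‖ ≤ 1280(√(dim o)D)³ + 200704(√(dim o)D)⁴`. -/
theorem karcher_base_local {q : ν → ℝ} (hq : ∀ x, 0 ≤ q x) (hq1 : ∑ x, q x = 1) {τ : ν → Matrix o o ℝ} (hτ : ∀ x, (τ x)ᵀ * τ x = 1)
    {x₀ : ν} (hx₀ : q x₀ ≠ 0) {D : ℝ} (hD0 : 0 ≤ D)
    (hloop : ∀ x x', q x ≠ 0 → q x' ≠ 0 → ∀ w : o → ℝ,
      ((((τ x)ᵀ * τ x') - 1) *ᵥ w) ⬝ᵥ ((((τ x)ᵀ * τ x') - 1) *ᵥ w) ≤ D ^ 2 * (w ⬝ᵥ w))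
    (hD200 : Real.sqrt (Fintype.card o) * D ≤ 1 / 200) :
    ∃ (V : Matrix o o ℝ) (C : {x : ν // q x ≠ 0} → Matrix o o ℝ), Vᵀ * V = 1 ∧ ‖V * (τ x₀)ᵀ - 1‖ ≤ 8 * (Real.sqrt (Fintype.card o) * D) ∧
      (∀ x, (C x)ᵀ = -C x) ∧ (∀ x, exp (C x) * V = τ x) ∧ (∀ x, ‖C x‖ ≤ 8 * (Real.sqrt (Fintype.card o) * D)) ∧
      ∑ x : {x : ν // q x ≠ 0}, q x • C x = 0 ∧
      ∀ R' : Matrix o o ℝ, R'ᵀ * R' = 1 → ((∑ x, q x • τ x) * R'ᵀ)ᵀ = (∑ x, q x • τ x) * R'ᵀ →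
        (∀ w : o → ℝ, 0 ≤ w ⬝ᵥ (((∑ x, q x • τ x) * R'ᵀ) *ᵥ w)) →
        ‖R' - V‖ ≤ 1280 * (Real.sqrt (Fintype.card o) * D) ^ 3 + 200704 * (Real.sqrt (Fintype.card o) * D) ^ 4 := by
  have hq' : ∀ x : {x : ν // q x ≠ 0}, 0 ≤ q x := fun x => hq x
  have hq1' : ∑ x : {x : ν // q x ≠ 0}, q x = 1 := by rw [sum_support_weight, hq1]
  have hτ' : ∀ x : {x : ν // q x ≠ 0}, (τ x)ᵀ * τ x = 1 := fun x => hτ x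
  have hD : ∀ x : {x : ν // q x ≠ 0}, ‖τ x * (τ x₀)ᵀ - 1‖ ≤ Real.sqrt (Fintype.card o) * D := fun x => by
    rw [frob_loop_base_change (hτ x₀)]
    exact frob_norm_le_sqrt_card_mul hD0 (hloop x₀ x hx₀ x.2)
  obtain ⟨V, C, hV, hV1, hCt, hCe, hC8, h0, hpol⟩ := karcher_base_of_transports hq' hq1' hτ' (hτ x₀) hD hD200
  refine ⟨V, C, hV, hV1, hCt, hCe, hC8, h0, fun R' hR' hsym hpsd => hpol R' hR' ?_ ?_⟩
  · rw [sum_support_smul]; exact hsym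
  · rw [sum_support_smul]; exact hpsd

/-- **`transferLetter_karcher_local` — PART 56's `hτ` FOR THE (1.27) ∕ (1.29) LINKS, FROM THE SUPPORT-LOCAL LOOP LETTER** [our proof].  Bond-indexed data in PART
58 ∕ 62's letters: weights `q(y,x) ≥ 0`, `Σ_x q(y,x) = 1`, orthogonal open transports `τ e′ x`, the POINTWISE loop letter for pairs of sites of nonzero weight
with `0 ≤ D`, `√(dim o)·D ≤ 1∕200`, and ANY prescribed roots `x₀ e′` of nonzero weight.  THEN there are orthogonal Karcher bases `V e′`
(`‖V e′·(τ e′ (x₀ e′))ᵀ − 1‖ ≤ 8D_F`) with skew logarithms `C e′ x` on the supports (`exp(C e′ x)·V e′ = τ e′ x`, `‖C e′ x‖ ≤ 8D_F`,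
`Σ_{q≠0} q(src′e′,x)•C e′ x = 0`) such that for EVERY family `R′` with `hR′` (orthogonal), `hsym` (`Σ_x q(src′e′,x)•(1 − τ e′ x·(R′e′)ᵀ)` symmetric) and
`hPpsd`: `∀ e′ w, |(V e′ − R′e′)w|² ≤ (1280D_F³ + 200704D_F⁴)²|w|²`, `D_F = √(dim o)·D`. -/
theorem transferLetter_karcher_local {μ β' : Type*} {q : μ → ν → ℝ} (hq : ∀ y x, 0 ≤ q y x) (hq1 : ∀ y, ∑ x, q y x = 1)
    {src' : β' → μ} {τ : β' → ν → Matrix o o ℝ} (hτ : ∀ e' x, (τ e' x)ᵀ * τ e' x = 1) {D : ℝ} (hD0 : 0 ≤ D)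
    (hloop : ∀ e' x x', q (src' e') x ≠ 0 → q (src' e') x' ≠ 0 → ∀ w : o → ℝ,
      ((((τ e' x)ᵀ * τ e' x') - 1) *ᵥ w) ⬝ᵥ ((((τ e' x)ᵀ * τ e' x') - 1) *ᵥ w) ≤ D ^ 2 * (w ⬝ᵥ w))
    (hD200 : Real.sqrt (Fintype.card o) * D ≤ 1 / 200) {x₀ : β' → ν} (hx₀ : ∀ e', q (src' e') (x₀ e') ≠ 0) :
    ∃ (V : β' → Matrix o o ℝ) (C : ∀ e' : β', {x : ν // q (src' e') x ≠ 0} → Matrix o o ℝ),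
      (∀ e', (V e')ᵀ * V e' = 1) ∧ (∀ e', ‖V e' * (τ e' (x₀ e'))ᵀ - 1‖ ≤ 8 * (Real.sqrt (Fintype.card o) * D)) ∧
      (∀ e' x, (C e' x)ᵀ = -C e' x) ∧ (∀ e' x, exp (C e' x) * V e' = τ e' x) ∧
      (∀ e' x, ‖C e' x‖ ≤ 8 * (Real.sqrt (Fintype.card o) * D)) ∧
      (∀ e', ∑ x : {x : ν // q (src' e') x ≠ 0}, q (src' e') x • C e' x = 0) ∧
      ∀ R' : β' → Matrix o o ℝ, (∀ e', (R' e')ᵀ * R' e' = 1) →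
        (∀ e', (∑ x, q (src' e') x • (1 - τ e' x * (R' e')ᵀ))ᵀ = ∑ x, q (src' e') x • (1 - τ e' x * (R' e')ᵀ)) →
        (∀ e' (w : o → ℝ), 0 ≤ w ⬝ᵥ ((∑ x, q (src' e') x • (τ e' x * (R' e')ᵀ)) *ᵥ w)) →
        ∀ e' (w : o → ℝ), ((V e' - R' e') *ᵥ w) ⬝ᵥ ((V e' - R' e') *ᵥ w) ≤
          (1280 * (Real.sqrt (Fintype.card o) * D) ^ 3 + 200704 * (Real.sqrt (Fintype.card o) * D) ^ 4) ^ 2 * (w ⬝ᵥ w) := by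
  have h : ∀ e', ∃ (Ve : Matrix o o ℝ) (Ce : {x : ν // q (src' e') x ≠ 0} → Matrix o o ℝ), Veᵀ * Ve = 1 ∧
      ‖Ve * (τ e' (x₀ e'))ᵀ - 1‖ ≤ 8 * (Real.sqrt (Fintype.card o) * D) ∧ (∀ x, (Ce x)ᵀ = -Ce x) ∧ (∀ x, exp (Ce x) * Ve = τ e' x) ∧
      (∀ x, ‖Ce x‖ ≤ 8 * (Real.sqrt (Fintype.card o) * D)) ∧ ∑ x : {x : ν // q (src' e') x ≠ 0}, q (src' e') x • Ce x = 0 ∧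
      ∀ R' : Matrix o o ℝ, R'ᵀ * R' = 1 → ((∑ x, q (src' e') x • τ e' x) * R'ᵀ)ᵀ = (∑ x, q (src' e') x • τ e' x) * R'ᵀ →
        (∀ w : o → ℝ, 0 ≤ w ⬝ᵥ (((∑ x, q (src' e') x • τ e' x) * R'ᵀ) *ᵥ w)) →
        ‖R' - Ve‖ ≤ 1280 * (Real.sqrt (Fintype.card o) * D) ^ 3 + 200704 * (Real.sqrt (Fintype.card o) * D) ^ 4 := fun e' =>
    karcher_base_local (hq (src' e')) (hq1 (src' e')) (hτ e') (hx₀ e') hD0 (hloop e') hD200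
  choose V C hV hV1 hCt hCe hC8 h0 hb using h
  refine ⟨V, C, hV, hV1, hCt, hCe, hC8, h0, fun R' hR' hsym hPpsd e' w => ?_⟩
  obtain ⟨hs, hp⟩ := polarLetters_of_defectLetters (hq1 (src' e')) (hsym e') (hPpsd e')
  have hbe := hb e' (R' e') (hR' e') hs hp
  rw [← norm_neg, neg_sub] at hbe
  refine (mulVec_dotProduct_self_le_frob _ w).trans (mul_le_mul_of_nonneg_right (pow_le_pow_left₀ (norm_nonneg _) hbe 2) ?_)
  simpa only [dotProduct] using Finset.sum_nonneg fun i _ => mul_self_nonneg (w i)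

end Summit.QuantumFields.BalabanUV.Beta.GAN24.DerivativeRateTransferJensenMassFreeKarcherLocal

end
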